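import Summits.NavierStokesRegularity.NavierStokesRegularity.Theorems.Target.Negative.CounterexampleProfile
import Summits.NavierStokesRegularity.NavierStokesRegularity.Theorems.Target.Negative.NormalForms
import Literature.Analysis.FluidPDE.NSLerayOseenRepresentation
import Literature.Analysis.FluidPDE.NSLerayBlowupRateTopHolds
import Literature.Analysis.FluidPDE.TaoLocalisationHolds
import Literature.Analysis.FluidPDE.NSCriticalClosureProofs
import Literature.Analysis.FluidPDE.NSBoundedMildOseenRestart
import Literature.Analysis.FluidPDE.NSBoundedMildSmoothing
import Literature.Analysis.FluidPDE.NSLerayHopfSereginProofs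
import Literature.Analysis.UnboundedOperators.HeatKernelSmooth
import Literature.Analysis.FluidPDE.ClassicalSolutionRescale
import Literature.Analysis.FluidPDE.NSLerayHopfABCScaling
import Literature.Analysis.FluidPDE.SereginSverak2002PressureLowerBoundProofs
import HarnessLib

/-!
# Crux `NoTypeIBlowup` (stmt-NavierStokesRegularity-1217), line `head-flux-channel`:
  stub S1a `stub_typeIZoom`, helper 2 — facts about a Clay-class solution and `ν ↦ 1`

Helper file (theorems only) towards the Type-I zoom `stub_typeIZoom`. For `ν > 0`, `T > 0` and a
classical solution `(u, p)` of the unforced Navier–Stokes system on `ℝ³ × [0, T)` which is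
Leray–Hopf on `[0, T)` from its rapidly decaying datum `u 0`:

* (imported from the refuters' landed negative lane, `Theorems/Target/Negative/`:
  `pointwise_bounded_before` — `u` is bounded POINTWISE on every `[0, T'] × ℝ³`, `T' < T`, Tao
  2013 slab bound upgraded by joint continuity; `tendsto_const_mul_nhdsLT`);
* `typeIZoom_leray_point` — if `u` does not extend classically past `T`, then at every time
  `t ∈ [0, T)` some point carries Leray's lower rate: `c √ν / √(T − t) ≤ ‖u t x‖` for a universal
  `c > 0` (Leray 1934, §19; `leray_blowup_rate_top_holds` read at a point of a continuous slice);
* `typeIZoom_oseen_pairs` — the OSEEN INTEGRAL EQUATION BETWEEN ALL PAIRS OF TIMES: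
  `u t x = e^{ν(t−s)Δ} u s (x) − B^ν_s(u, u)(t)(x)` pointwise for all `0 < s < t < T`
  (duality-form mildness of Leray–Hopf solutions `isMildNSSolutionOn_of_isLerayHopfOn_holds`,
  the representation from the datum `ae_eq_heatExtension_sub_oseenDuhamel_of_isMildNSSolutionOn`,
  the restart `oseenMild_restart_holds` (KNSS 2009, §4), and the a.e.-to-pointwise upgrade by
  continuity of both sides: `contDiff_heatExtension_holds`, `continuous_oseenDuhamel_slice`);
* `typeIZoom_unit_viscosity` — the viscosity normalisation `v(s, x) = ν⁻¹ u(s/ν, x)` (Tao 2013,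
  footnote 3) transporting all five clauses of the crux to viscosity `1` on `[0, νT)`, with the
  SAME rate constant `C` (`√(T − t)‖u‖ ≤ C√ν` becomes `√(νT − s)‖v‖ ≤ C`) and the failure to
  extend (an extension of `v` scales back by `IsClassicalNSSolutionOn.stRescale`); the pattern of
  `targetAt_of_viscosity_one` in `Cruxes/Target/Disproof.lean`, §6 (copied, not imported).

Lands `--supports stmt-NavierStokesRegularity-1217` (registered sub-goal `typeIZoom_oseen_pairs`).
-/

noncomputable section

namespace Summit.NavierStokesRegularity.NavierStokesRegularity.Theorems

open MeasureTheory Set Filter Topology Function Metric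
open scoped RealInnerProductSpace NNReal ENNReal
open Literature.Analysis Literature.Analysis.FluidPDE

/-! ### Leray's lower bound, read at a point -/

/-- **Leray's lower rate at a point.** There is a universal `c > 0` (half of Leray's constant of
`leray_blowup_rate_top_holds`) such that for every Clay-class solution (`ν > 0`, `T > 0`,
classical on `[0, T)`, Leray–Hopf from its rapidly decaying datum) which does NOT extend
classically past `T`, at every time `t ∈ [0, T)` some point `x` carries
`c √ν / √(T − t) ≤ ‖u t x‖` (otherwise the slice, hence its `L^∞` norm, would stay below
Leray's lower bound `2c √ν / √(T − t)`). [cite: Leray1934, §19 (3.8)–(3.9) p. 224] -/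
theorem typeIZoom_leray_point :
    ∃ c : ℝ, 0 < c ∧ ∀ ⦃ν T : ℝ⦄ ⦃u : ℝ → EuclideanSpace ℝ (Fin 3) → EuclideanSpace ℝ (Fin 3)⦄
      ⦃p : ℝ → EuclideanSpace ℝ (Fin 3) → ℝ⦄, 0 < ν → 0 < T →
      IsClassicalNSSolutionOn (Ico 0 T) ν 0 u p → IsLerayHopfOn T ν 0 (u 0) u →
      HasRapidSpatialDecay (u 0) → ¬ HasSmoothExtensionPast ν 0 u T →
      ∀ t ∈ Ico 0 T, ∃ x, c * Real.sqrt ν / Real.sqrt (T - t) ≤ ‖u t x‖ := by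
  obtain ⟨c₀, hc₀, h⟩ := leray_blowup_rate_top_holds
  refine ⟨c₀ / 2, by positivity, fun ν T u p hν hT hcl hLH hdec hext t ht => ?_⟩
  have hlow := h ν T hν hT u p ⟨hcl, hext⟩ hLH
    (eLpNorm_uncurry_top_lt_top_of_tao2011 tao2011_hasBoundedSobolevNormsOn_holds hν hcl hLH hdec)
    t ht
  by_contra hno
  push Not at hno
  set b : ℝ := c₀ / 2 * Real.sqrt ν / Real.sqrt (T - t) with hb
  have hsq : 0 < Real.sqrt (T - t) := Real.sqrt_pos.2 (sub_pos.2 ht.2)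
  have hbpos : 0 < b := by rw [hb]; positivity
  have hup : eLpNorm (u t) ⊤ volume ≤ ENNReal.ofReal b := by
    rw [eLpNorm_exponent_top]
    exact eLpNormEssSup_le_of_ae_bound (ae_of_all _ fun x => (hno x).le)
  have hle := (ENNReal.ofReal_le_ofReal_iff hbpos.le).1 (hlow.trans hup)
  have h2b : c₀ * Real.sqrt ν / Real.sqrt (T - t) = 2 * b := by rw [hb]; ring
  rw [h2b] at hle
  linarith

/-! ### The Oseen integral equation between all pairs of times -/

/-- **The Oseen integral equation between all pairs of times for a Clay-class solution.** Let
`ν > 0`, `T > 0`, `(u, p)` classical on `ℝ³ × [0, T)`, Leray–Hopf on `[0, T)` from its rapidly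
decaying datum `u 0`. Then for all `0 < s < t < T` and all `x`,
`u t x = (e^{ν(t−s)Δ} u s)(x) − B^ν_s(u, u)(t)(x)` (`UnboundedOperators.heatExtension`,
`oseenDuhamel`; POINTWISE). Proof: `u` is bounded on every `[0, T'] × ℝ³`
(`Target.Negative.pointwise_bounded_before`), duality-form mild from `u 0`
(`isMildNSSolutionOn_of_isLerayHopfOn_holds`), hence `u t' = e^{νt'Δ}u 0 − B^ν_0(u,u)(t')` a.e.
for every `t' ∈ (0, T)` (`ae_eq_heatExtension_sub_oseenDuhamel_of_isMildNSSolutionOn`: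
Lemarié-Rieusset 2016 Thm. 6.1 / Fabes–Jones–Rivière 1972); the Oseen equation restarts at
every intermediate time (`oseenMild_restart_holds`, KNSS 2009 §4 p. 8, "as an ODE in `t`"),
a.e.; both sides are continuous in `x` (classical slice; `contDiff_heatExtension_holds`,
`continuous_oseenDuhamel_slice`), so the identity holds everywhere.
[cite: KochNadirashviliSereginSverak2009, §4 (i) and Remark 4.1 (arXiv:0709.3599 p. 8)] -/
theorem typeIZoom_oseen_pairs :
    ∀ (ν T : ℝ) (u : ℝ → EuclideanSpace ℝ (Fin 3) → EuclideanSpace ℝ (Fin 3))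
      (p : ℝ → EuclideanSpace ℝ (Fin 3) → ℝ), 0 < ν → 0 < T →
      Literature.Analysis.FluidPDE.IsClassicalNSSolutionOn (Set.Ico 0 T) ν 0 u p →
      Literature.Analysis.FluidPDE.IsLerayHopfOn T ν 0 (u 0) u →
      Literature.Analysis.FluidPDE.HasRapidSpatialDecay (u 0) →
      ∀ s t : ℝ, 0 < s → s < t → t < T → ∀ x,
        u t x = Literature.Analysis.UnboundedOperators.heatExtension (u s) (ν * (t - s)) x -
          Literature.Analysis.FluidPDE.oseenDuhamel ν s u u t x := by
  intro ν T u p hν hT hcl hLH hdec s t hs hst htT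
  haveI : Nontrivial (EuclideanSpace ℝ (Fin 3)) := inferInstance
  -- continuity and measurability
  have hcont : ContinuousOn (uncurry u) (Ico 0 T ×ˢ univ) := hcl.smooth_velocity.continuousOn
  have hslice : ∀ τ ∈ Ico 0 T, Continuous (u τ) := fun τ hτ =>
    hcont.comp_continuous (Continuous.prodMk_right τ) fun x => ⟨hτ, mem_univ x⟩
  have hmeasIoo : ∀ a b : ℝ, 0 ≤ a → b ≤ T → AEStronglyMeasurable (uncurry u)
      ((volume : Measure (ℝ × EuclideanSpace ℝ (Fin 3))).restrict (Ioo a b ×ˢ univ)) :=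
    fun a b ha hb => (hcont.mono (prod_mono (fun τ hτ => ⟨ha.trans hτ.1.le, hτ.2.trans_le hb⟩)
      Subset.rfl)).aestronglyMeasurable (measurableSet_Ioo.prod MeasurableSet.univ)
  -- pointwise bounds on closed sub-slabs
  have hbdd := Target.Negative.pointwise_bounded_before hν hcl hLH hdec
  -- duality-form mildness from the datum
  have hmildT : IsMildNSSolutionOn (Ioc 0 T) ν 0 (u 0) u :=
    isMildNSSolutionOn_of_isLerayHopfOn_holds hν hT (hLH.memLp 0 ⟨le_rfl, hT.le⟩) hLH
  have hdiv0 : IsWeaklyDivFree (u 0) :=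
    VectorCalculus.IsDivFree.isWeaklyDivFree_holds (hcl.divFree 0 ⟨le_rfl, hT⟩)
      ((hcl.contDiff_velocity ⟨le_rfl, hT⟩).of_le (by simp))
  -- ## Step 1: the representation from the datum, a.e., at every `t' ∈ (0, T)`
  have hrep0 : ∀ t' ∈ Ioo 0 T, u t' =ᵐ[volume] fun x =>
      UnboundedOperators.heatExtension (u 0) (ν * t') x - oseenDuhamel ν 0 u u t' x := by
    intro t' ht'
    obtain ⟨M, hM⟩ := hbdd t' ht'.2
    have hM1 : ∀ τ ∈ Icc 0 t', ∀ y, ‖u τ y‖ ≤ max M 1 := fun τ hτ y =>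
      (hM τ hτ y).trans (le_max_left _ _)
    exact ae_eq_heatExtension_sub_oseenDuhamel_of_isMildNSSolutionOn
      (E := EuclideanSpace ℝ (Fin 3)) hν ht'.1 (hmildT.mono (Ioc_subset_Ioc_right ht'.2.le))
      (hmeasIoo 0 t' le_rfl ht'.2.le)
      (fun τ hτ => (hslice τ ⟨hτ.1, hτ.2.trans_lt ht'.2⟩).aestronglyMeasurable)
      (lt_max_of_lt_right one_pos) hM1 hdiv0
      (fun τ hτ => hLH.memLp τ ⟨hτ.1, hτ.2.trans ht'.2.le⟩) ⟨ht'.1, le_rfl⟩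
  -- ## Step 2: restart at every intermediate time, a.e.
  have hbound : ∀ T₁ ∈ Ioo 0 T, ∃ C : ℝ≥0∞, C < ∞ ∧ ∀ τ ∈ Ico 0 T₁, eLpNorm (u τ) ∞ volume ≤ C := by
    intro T₁ hT₁
    obtain ⟨M, hM⟩ := hbdd T₁ hT₁.2
    refine ⟨ENNReal.ofReal M, ENNReal.ofReal_lt_top, fun τ hτ => ?_⟩
    rw [eLpNorm_exponent_top]
    exact eLpNormEssSup_le_of_ae_bound (ae_of_all _ (hM τ ⟨hτ.1, hτ.2.le⟩))
  have hae : u t =ᵐ[volume] fun x =>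
      UnboundedOperators.heatExtension (u s) (ν * (t - s)) x - oseenDuhamel ν s u u t x :=
    oseenMild_restart_holds (EuclideanSpace ℝ (Fin 3)) hν hT (hmeasIoo 0 T le_rfl le_rfl)
      (hslice 0 ⟨le_rfl, hT⟩).aestronglyMeasurable hbound hrep0 hs hst htT
  -- ## Step 3: both sides are continuous, hence equal everywhere
  obtain ⟨M, hM⟩ := hbdd t htT
  have hM0 : 0 ≤ max M 1 := zero_le_one.trans (le_max_right _ _)
  have hsI : s ∈ Ico 0 T := ⟨hs.le, hst.trans htT⟩
  have hus_top : MemLp (u s) ∞ (volume : Measure (EuclideanSpace ℝ (Fin 3))) :=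
    memLp_top_of_bound (hslice s hsI).aestronglyMeasurable M
      (Eventually.of_forall (hM s ⟨hs.le, hst.le⟩))
  have hheat : Continuous (UnboundedOperators.heatExtension (u s) (ν * (t - s))) :=
    (UnboundedOperators.contDiff_heatExtension_holds hus_top le_top
      (mul_pos hν (sub_pos.2 hst))).continuous
  have hum : AEStronglyMeasurable (uncurry u)
      ((volume : Measure (ℝ × EuclideanSpace ℝ (Fin 3))).restrict (Ioo s t ×ˢ univ)) :=
    hmeasIoo s t hs.le htT.le
  have huM : ∀ τ ∈ Ioo s t, ∀ y, ‖u τ y‖ ≤ max M 1 := fun τ hτ y =>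
    (hM τ ⟨hs.le.trans hτ.1.le, hτ.2.le⟩ y).trans (le_max_left _ _)
  have hduh : Continuous (oseenDuhamel ν s u u t) :=
    continuous_oseenDuhamel_slice hν hM0 hum hum huM huM hst le_rfl
  have heq : u t = fun x =>
      UnboundedOperators.heatExtension (u s) (ν * (t - s)) x - oseenDuhamel ν s u u t x :=
    (Continuous.ae_eq_iff_eq volume (hslice t ⟨hs.le.trans hst.le, htT⟩) (hheat.sub hduh)).1 hae
  intro x
  exact congrFun heq x

/-! ### The viscosity normalisation `ν ↦ 1` -/

/-- **Viscosity normalisation of the hypotheses of the crux, keeping the rate constant.** Let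
`ν > 0`, `T > 0`, `(u, p)` classical on `ℝ³ × [0, T)` with viscosity `ν`, Leray–Hopf from its
rapidly decaying datum, with the eventual rate `√(T − t)‖u(t, x)‖ ≤ C√ν`, NOT extending
classically past `T`. Then `v(s, x) = ν⁻¹ u(s/ν, x)`, `π(s, x) = ν⁻² p(s/ν, x)` is classical on
`ℝ³ × [0, νT)` with viscosity `1`, Leray–Hopf from its rapidly decaying datum `v 0 = ν⁻¹ u 0`,
satisfies `√(νT − s)‖v(s, x)‖ ≤ C` eventually as `s ↑ νT`, and does not extend classically past
`νT` (Tao 2013, footnote 3; the extension would scale back by Leray's similarity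
`IsClassicalNSSolutionOn.stRescale`). [cite: Tao2011, footnote 3] -/
theorem typeIZoom_unit_viscosity :
    ∀ (C ν T : ℝ) (u : ℝ → EuclideanSpace ℝ (Fin 3) → EuclideanSpace ℝ (Fin 3))
      (p : ℝ → EuclideanSpace ℝ (Fin 3) → ℝ), 0 < ν → 0 < T →
      Literature.Analysis.FluidPDE.IsClassicalNSSolutionOn (Set.Ico 0 T) ν 0 u p →
      Literature.Analysis.FluidPDE.IsLerayHopfOn T ν 0 (u 0) u →
      Literature.Analysis.FluidPDE.HasRapidSpatialDecay (u 0) →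
      (∀ᶠ t in nhdsWithin T (Set.Iio T), ∀ x, Real.sqrt (T - t) * ‖u t x‖ ≤ C * Real.sqrt ν) →
      ¬ Literature.Analysis.FluidPDE.HasSmoothExtensionPast ν 0 u T →
      ∃ (v : ℝ → EuclideanSpace ℝ (Fin 3) → EuclideanSpace ℝ (Fin 3))
        (π : ℝ → EuclideanSpace ℝ (Fin 3) → ℝ),
        Literature.Analysis.FluidPDE.IsClassicalNSSolutionOn (Set.Ico 0 (ν * T)) 1 0 v π ∧
        Literature.Analysis.FluidPDE.IsLerayHopfOn (ν * T) 1 0 (v 0) v ∧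
        Literature.Analysis.FluidPDE.HasRapidSpatialDecay (v 0) ∧
        (∀ᶠ s in nhdsWithin (ν * T) (Set.Iio (ν * T)), ∀ x,
          Real.sqrt (ν * T - s) * ‖v s x‖ ≤ C) ∧
        ¬ Literature.Analysis.FluidPDE.HasSmoothExtensionPast 1 0 v (ν * T) := by
  -- pattern copied from `Cruxes/Target/Disproof.lean`, §6 `targetAt_of_viscosity_one`
  intro C ν T u p hν hT hcl hLH hdec hrate hext
  have hν0 : ν ≠ 0 := hν.ne'
  have hνi : 0 < ν⁻¹ := inv_pos.2 hν
  have hνT : 0 < ν * T := mul_pos hν hT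
  set v : ℝ → EuclideanSpace ℝ (Fin 3) → EuclideanSpace ℝ (Fin 3) := timeRescale ν⁻¹ ν⁻¹ u
    with hv
  set π : ℝ → EuclideanSpace ℝ (Fin 3) → ℝ := timeRescale ν⁻¹ (ν⁻¹ ^ 2) p with hπ
  have hmaps : MapsTo (fun s => ν⁻¹ * s) (Ico 0 (ν * T)) (Ico 0 T) := by
    intro s hs
    refine ⟨mul_nonneg hνi.le hs.1, ?_⟩
    calc ν⁻¹ * s < ν⁻¹ * (ν * T) := mul_lt_mul_of_pos_left hs.2 hνi
      _ = T := by rw [← mul_assoc, inv_mul_cancel₀ hν0, one_mul]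
  -- (1) classical at viscosity 1 on `[0, νT)`
  have hclv : IsClassicalNSSolutionOn (Ico 0 (ν * T)) 1 0 v π := by
    have h := hcl.viscosityRescale_set hν0 hmaps (uniqueDiffOn_Ico 0 (ν * T))
    rwa [timeRescale_zero_force] at h
  -- (2) Leray–Hopf
  have hv0 : ν⁻¹ • u 0 = v 0 := by
    funext x
    simp [hv]
  have hLHv : IsLerayHopfOn (ν * T) 1 0 (v 0) v := by
    have h := hLH.viscosityRescale hνi
    have e1 : T / ν⁻¹ = ν * T := by rw [div_inv_eq_mul, mul_comm]
    rwa [e1, inv_mul_cancel₀ hν0, timeRescale_zero_force, hv0] at h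
  -- (3) decay of the datum
  have hdecv : HasRapidSpatialDecay (v 0) := by
    rw [← hv0]
    exact SereginSverak2002_pressureOneSidedBound.hasRapidSpatialDecay_const_smul
      (hcl.contDiff_velocity ⟨le_rfl, hT⟩) hdec ν⁻¹
  -- (4) the rate, same constant
  have hratev : ∀ᶠ s in 𝓝[<] (ν * T), ∀ x, Real.sqrt (ν * T - s) * ‖v s x‖ ≤ C := by
    have ht : Tendsto (fun s : ℝ => ν⁻¹ * s) (𝓝[<] (ν * T)) (𝓝[<] T) := by
      have := Target.Negative.tendsto_const_mul_nhdsLT (T := T) hνi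
      rwa [inv_inv] at this
    filter_upwards [ht.eventually hrate, self_mem_nhdsWithin] with s hs hsT x
    have hsT' : s < ν * T := hsT
    have hpos : 0 < ν * T - s := sub_pos.2 hsT'
    have e : T - ν⁻¹ * s = ν⁻¹ * (ν * T - s) := by field_simp
    have hsq : Real.sqrt (T - ν⁻¹ * s) = (Real.sqrt ν)⁻¹ * Real.sqrt (ν * T - s) := by
      rw [e, Real.sqrt_mul hνi.le, Real.sqrt_inv]
    have hb := hs x
    have hsν : 0 < Real.sqrt ν := Real.sqrt_pos.2 hν
    have hsνsq : Real.sqrt ν * Real.sqrt ν = ν := Real.mul_self_sqrt hν.le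
    show Real.sqrt (ν * T - s) * ‖ν⁻¹ • u (ν⁻¹ * s) x‖ ≤ C
    rw [norm_smul, Real.norm_eq_abs, abs_of_pos hνi]
    rw [hsq] at hb
    -- `hb : (√ν)⁻¹ √(νT − s) ‖u‖ ≤ C √ν`
    have key : Real.sqrt (ν * T - s) * ‖u (ν⁻¹ * s) x‖ ≤ C * ν := by
      have h2 := mul_le_mul_of_nonneg_left hb hsν.le
      rw [← mul_assoc, ← mul_assoc, mul_inv_cancel₀ hsν.ne', one_mul] at h2
      calc Real.sqrt (ν * T - s) * ‖u (ν⁻¹ * s) x‖ ≤ Real.sqrt ν * (C * Real.sqrt ν) := h2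
        _ = C * (Real.sqrt ν * Real.sqrt ν) := by ring
        _ = C * ν := by rw [hsνsq]
    calc Real.sqrt (ν * T - s) * (ν⁻¹ * ‖u (ν⁻¹ * s) x‖)
        = ν⁻¹ * (Real.sqrt (ν * T - s) * ‖u (ν⁻¹ * s) x‖) := by ring
      _ ≤ ν⁻¹ * (C * ν) := mul_le_mul_of_nonneg_left key hνi.le
      _ = C := by field_simp
  -- (5) no classical extension past `νT`: it would scale back to an extension of `u` past `T`
  have hextv : ¬ HasSmoothExtensionPast 1 0 v (ν * T) := by
    rintro ⟨T₁', hT₁', v', π', hcl', hagree'⟩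
    apply hext
    have key := hcl'.stRescale hν one_pos (by rw [mul_one]) 0 0
    have hset : ((fun r => (0 : ℝ) + ν * r) ⁻¹' Ico 0 T₁') = Ico 0 (T₁' / ν) := by
      ext r
      simp only [mem_preimage, zero_add, mem_Ico]
      rw [lt_div_iff₀ hν, mul_comm r ν]
      constructor
      · rintro ⟨h0, h1⟩
        exact ⟨by nlinarith [h0], h1⟩
      · rintro ⟨h0, h1⟩
        exact ⟨by positivity, h1⟩
    rw [hset, smul_stPull_zero, show ν * (1 : ℝ) / 1 = ν by simp] at key
    refine ⟨T₁' / ν, by rw [gt_iff_lt, lt_div_iff₀ hν, mul_comm]; exact hT₁', _, _, key,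
      fun t ht => ?_⟩
    funext x
    have hνt : ν * t ∈ Ico 0 (ν * T) := ⟨mul_nonneg hν.le ht.1, mul_lt_mul_of_pos_left ht.2 hν⟩
    show ν • v' (0 + ν * t) (0 + (1 : ℝ) • x) = u t x
    rw [zero_add, zero_add, one_smul, hagree' (ν * t) hνt]
    show ν • (ν⁻¹ • u (ν⁻¹ * (ν * t)) x) = u t x
    rw [← mul_assoc, inv_mul_cancel₀ hν0, one_mul, smul_smul, mul_inv_cancel₀ hν0, one_smul]
  exact ⟨v, π, hclv, hLHv, hdecv, hratev, hextv⟩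

end Summit.NavierStokesRegularity.NavierStokesRegularity.Theorems

end
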